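import Mathlib

/-!
# DEQ-A257 receipt — the rewriting system `aaaa ↔ baba`, `baba ↔ bbbb`: conserved staggered charges, frozen words, and the glider / doublet-flip relations

HONEST FRAMING: instance-level adjudication of specific advantage claims; no claim about
BQP vs BPP or the summit.

Staging copy `pub-qadeq-deq-1/EquationalRewriting.lean` of unit pub-qadeq-deq-1 (gen 41; filed to the tree by the cell lead,
harvest-1 gen 28, minus the unproved statement `ClassificationA257`), for the note
`pub-qadeq-deq-1/DEQ-A257.md` on Rattacaso–Jaschke–Ballarin–Siloi–Montangero, *Quantum algorithms for
equational reasoning*, Science Advances 12, eaec2736 (2026) = arXiv:2508.21122v2 (bib key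
`RattacasoEtAl2026Equational`).  Nothing of that paper's quantum algorithm, tensor-network emulation or
complexity statements is formalised here.  What is checked is the elementary combinatorics of the paper's
benchmark string rewriting system, eq. (29): alphabet `{a, b}` (here `false = a`, `true = b`), rules
`aaaa ≈ baba` and `baba ≈ bbbb` applied at any window of a word, in both directions.

* `Rule`, `Step`, `Conn` — the rules, one move in context, and connectedness (reflexive–transitive closure;
  moves are symmetric, `step_symm`, so `Conn` is the paper's equivalence `X_{S,x} = X_{S,y}`).
* `D1`, `D2` — the two STAGGERED CHARGES of Theorem A257: `D1 = #{j ≡ 1 (4) : x_j = b} − #{j ≡ 3 (4) : x_j = b}`,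
  `D2 = #{j ≡ 2 (4) : x_j = b} − #{j ≡ 0 (4) : x_j = b}` (positions `1 … L`);
  `charges_step`, `charges_conn` — every move, hence connectedness, preserves both (Lemma 1 of the note).
* `Frozen`, `frozen_conn` — a word admitting no move is connected only to itself (Lemma 2).
* `conn_glider` (`aaaab ~ baaaa`, 4 moves), `conn_flip` (`abaaaaa ~ bbbaaaa`, 5 moves), `conn_flip₀`
  (`aaaaaaa ~ babaaaa`) — the relations (R1), (R2) of the note's §4 as explicit kernel-checked move chains;
  `conn_append` — relations hold in every context; `conn_glider_transport` — the glider transport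
  `p ++ aaaa ++ q ~ p ++ q ++ aaaa` (relation (G)).
* `classification_forward` — the proved half of Theorem A257 (i): connected words are equal, or both
  non-frozen with equal charges.  The converse (one class per charge sector among non-frozen words, via the
  sorting argument of Lemmas 4–5 of the note) is NOT formalised in this file (no statement of it is vendored
  here either — lead's gating edit, pub-qadeq harvest-1 gen 28: an unproved `Prop` would read as a fact);
  its informal proof is DEQ-A257.md §4 and it is verified exhaustively for all words of length `4 … 22` by the
  certificate C-A257 (two independent programs) and for `4 … 14` by the lead's third program.
-/

namespace Summit.QuantumAdvantage.Dequantization.EquationalRewriting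

/-- Words over `{a, b}`: `false` is the letter `a`, `true` is the letter `b`. -/
abbrev Word := List Bool

local notation "A" => false
local notation "B" => true

/-- The rules of eq. (29) of Rattacaso et al. as ordered pairs of 4-letter factors; both directions of
both rules are listed, so a move may apply a rule forwards or backwards. -/
def Rule (u v : Word) : Prop :=
  (u = [A, A, A, A] ∧ v = [B, A, B, A]) ∨ (u = [B, A, B, A] ∧ v = [A, A, A, A]) ∨
  (u = [B, A, B, A] ∧ v = [B, B, B, B]) ∨ (u = [B, B, B, B] ∧ v = [B, A, B, A])

/-- One move: rewrite one factor in context, `p ++ u ++ q ↦ p ++ v ++ q` with `Rule u v`. -/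
def Step (x y : Word) : Prop :=
  ∃ p u v q : Word, Rule u v ∧ x = p ++ u ++ q ∧ y = p ++ v ++ q

/-- Connectedness of words (the paper's `X_{S,x} = X_{S,y}`): reflexive–transitive closure of moves. -/
def Conn : Word → Word → Prop := Relation.ReflTransGen Step

/-- The rules are symmetric (each is listed with its reverse). -/
theorem rule_symm {u v : Word} (h : Rule u v) : Rule v u := by
  unfold Rule at *
  rcases h with ⟨rfl, rfl⟩ | ⟨rfl, rfl⟩ | ⟨rfl, rfl⟩ | ⟨rfl, rfl⟩ <;> simp

/-- Both sides of a rule have length 4. -/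
theorem rule_length {u v : Word} (h : Rule u v) : u.length = 4 ∧ v.length = 4 := by
  rcases h with ⟨rfl, rfl⟩ | ⟨rfl, rfl⟩ | ⟨rfl, rfl⟩ | ⟨rfl, rfl⟩ <;> simp

/-- One move is reversible. -/
theorem step_symm {x y : Word} (h : Step x y) : Step y x := by
  obtain ⟨p, u, v, q, hr, rfl, rfl⟩ := h
  exact ⟨p, v, u, q, rule_symm hr, rfl, rfl⟩

/-- Connectedness is symmetric. -/
theorem conn_symm {x y : Word} (h : Conn x y) : Conn y x := by
  unfold Conn at *
  induction h with
  | refl => exact Relation.ReflTransGen.refl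
  | tail _ hbc ih => exact Relation.ReflTransGen.head (step_symm hbc) ih

/-- Connectedness is reflexive. -/
theorem conn_refl (x : Word) : Conn x x := Relation.ReflTransGen.refl

/-- Connectedness is transitive. -/
theorem conn_trans {x y z : Word} (h₁ : Conn x y) (h₂ : Conn y z) : Conn x z :=
  Relation.ReflTransGen.trans h₁ h₂

/-- Moves act in context. -/
theorem step_append {x y : Word} (h : Step x y) (p q : Word) :
    Step (p ++ x ++ q) (p ++ y ++ q) := by
  obtain ⟨p', u, v, q', hr, rfl, rfl⟩ := h
  exact ⟨p ++ p', u, v, q' ++ q, hr, by simp [List.append_assoc], by simp [List.append_assoc]⟩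

/-- Connectedness is a congruence for concatenation: relations hold in every context. -/
theorem conn_append {x y : Word} (h : Conn x y) (p q : Word) :
    Conn (p ++ x ++ q) (p ++ y ++ q) := by
  unfold Conn at *
  induction h with
  | refl => exact Relation.ReflTransGen.refl
  | tail _ hbc ih => exact Relation.ReflTransGen.tail ih (step_append hbc p q)

/-! ### The two staggered charges -/

/-- Weight of position `j` (1-indexed) in the charge `D1`: `+1` at `j ≡ 1`, `−1` at `j ≡ 3 (mod 4)`. -/
def wt1 (j : ℕ) : ℤ := if j % 4 = 1 then 1 else if j % 4 = 3 then -1 else 0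

/-- Weight of position `j` (1-indexed) in the charge `D2`: `+1` at `j ≡ 2`, `−1` at `j ≡ 0 (mod 4)`. -/
def wt2 (j : ℕ) : ℤ := if j % 4 = 2 then 1 else if j % 4 = 0 then -1 else 0

/-- Weighted count of the letters `b` of a word whose first letter sits at position `off + 1`. -/
def sumFrom (f : ℕ → ℤ) : Word → ℕ → ℤ
  | [], _ => 0
  | c :: w, off => (if c then f (off + 1) else 0) + sumFrom f w (off + 1)

/-- `D1 x = #{j ≡ 1 (mod 4) : x_j = b} − #{j ≡ 3 (mod 4) : x_j = b}`. -/
def D1 (x : Word) : ℤ := sumFrom wt1 x 0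

/-- `D2 x = #{j ≡ 2 (mod 4) : x_j = b} − #{j ≡ 0 (mod 4) : x_j = b}`. -/
def D2 (x : Word) : ℤ := sumFrom wt2 x 0

/-- `sumFrom` of a concatenation splits, with the offset shifted by the length of the first word. -/
theorem sumFrom_append (f : ℕ → ℤ) (u v : Word) (off : ℕ) :
    sumFrom f (u ++ v) off = sumFrom f u off + sumFrom f v (off + u.length) := by
  induction u generalizing off with
  | nil => simp [sumFrom]
  | cons c u ih =>
    simp only [List.cons_append, sumFrom, ih, List.length_cons]
    rw [show off + 1 + u.length = off + (u.length + 1) by omega]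
    ring

/-- The weight of `D1` is antiperiodic with period 2 in the position. -/
theorem wt1_antiperiodic (j : ℕ) : wt1 (j + 2) = -wt1 j := by
  simp only [wt1]
  have h := Nat.mod_lt j (show 0 < 4 by norm_num)
  interval_cases hm : j % 4 <;> simp [Nat.add_mod, hm]

/-- The weight of `D2` is antiperiodic with period 2 in the position. -/
theorem wt2_antiperiodic (j : ℕ) : wt2 (j + 2) = -wt2 j := by
  simp only [wt2]
  have h := Nat.mod_lt j (show 0 < 4 by norm_num)
  interval_cases hm : j % 4 <;> simp [Nat.add_mod, hm]

/-- Each rule factor has weighted `b`-count zero for any antiperiodic weight, at any offset: `aaaa` has no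
`b`; `baba` contributes `f(off+1) + f(off+3) = 0`; `bbbb` contributes additionally `f(off+2) + f(off+4) = 0`. -/
theorem sumFrom_rule (f : ℕ → ℤ) (hf : ∀ j, f (j + 2) = -f j) {u v : Word} (h : Rule u v) (off : ℕ) :
    sumFrom f u off = sumFrom f v off := by
  have h13 : f (off + 1) + f (off + 3) = 0 := by
    have := hf (off + 1); rw [show off + 1 + 2 = off + 3 by omega] at this; linarith
  have h24 : f (off + 2) + f (off + 4) = 0 := by
    have := hf (off + 2); rw [show off + 2 + 2 = off + 4 by omega] at this; linarith
  have e2 : off + 1 + 1 = off + 2 := by omega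
  have e3 : off + 2 + 1 = off + 3 := by omega
  have e4 : off + 3 + 1 = off + 4 := by omega
  rcases h with ⟨rfl, rfl⟩ | ⟨rfl, rfl⟩ | ⟨rfl, rfl⟩ | ⟨rfl, rfl⟩ <;>
    simp only [sumFrom, if_true, if_false, Bool.false_eq_true, e2, e3, e4] <;> linarith

/-- LEMMA 1 of DEQ-A257 §4: every move preserves both charges. -/
theorem charges_step {x y : Word} (h : Step x y) : D1 x = D1 y ∧ D2 x = D2 y := by
  obtain ⟨p, u, v, q, hr, rfl, rfl⟩ := h
  obtain ⟨hu, hv⟩ := rule_length hr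
  simp only [D1, D2, sumFrom_append, List.length_append, hu, hv,
    sumFrom_rule wt1 wt1_antiperiodic hr, sumFrom_rule wt2 wt2_antiperiodic hr, and_self]

/-- Connected words carry equal charges. -/
theorem charges_conn {x y : Word} (h : Conn x y) : D1 x = D1 y ∧ D2 x = D2 y := by
  unfold Conn at h
  induction h with
  | refl => exact ⟨rfl, rfl⟩
  | tail _ hbc ih =>
    have h2 := charges_step hbc
    exact ⟨ih.1.trans h2.1, ih.2.trans h2.2⟩

/-- Moves preserve length. -/
theorem length_step {x y : Word} (h : Step x y) : x.length = y.length := by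
  obtain ⟨p, u, v, q, hr, rfl, rfl⟩ := h
  obtain ⟨hu, hv⟩ := rule_length hr
  simp [hu, hv]

/-- Connected words have equal length. -/
theorem length_conn {x y : Word} (h : Conn x y) : x.length = y.length := by
  unfold Conn at h
  induction h with
  | refl => rfl
  | tail _ hbc ih => exact ih.trans (length_step hbc)

/-! ### Frozen words -/

/-- A word is frozen if no move applies (it contains none of the factors `aaaa`, `baba`, `bbbb`). -/
def Frozen (x : Word) : Prop := ¬ ∃ y, Step x y

/-- A word is non-frozen if some move applies. -/
def NonFrozen (x : Word) : Prop := ∃ y, Step x y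

/-- LEMMA 2 of DEQ-A257 §4: a frozen word is connected only to itself. -/
theorem frozen_conn {x y : Word} (hx : Frozen x) (h : Conn x y) : y = x := by
  unfold Conn at h
  induction h using Relation.ReflTransGen.head_induction_on with
  | refl => rfl
  | head hstep _ _ => exact absurd ⟨_, hstep⟩ hx

/-- The proved half of THEOREM A257 (i): connected words are equal, or both are non-frozen and carry equal
charges `(D1, D2)`. -/
theorem classification_forward {x y : Word} (h : Conn x y) :
    x = y ∨ (NonFrozen x ∧ NonFrozen y ∧ D1 x = D1 y ∧ D2 x = D2 y) := by
  by_cases hxy : x = y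
  · exact Or.inl hxy
  · right
    have hc := charges_conn h
    have hnx : NonFrozen x := by
      by_contra hf
      exact hxy (frozen_conn hf h).symm
    have hny : NonFrozen y := by
      by_contra hf
      exact hxy (frozen_conn hf (conn_symm h))
    exact ⟨hnx, hny, hc.1, hc.2⟩

/-! ### The relations (R0)–(R2) and the glider transport (G) of DEQ-A257 §4, as explicit move chains -/

/-- (R0) `aaaa → baba`. -/
theorem step_r0a : Step [A, A, A, A] [B, A, B, A] :=
  ⟨[], [A, A, A, A], [B, A, B, A], [], by simp [Rule], rfl, rfl⟩

/-- (R0) `baba → bbbb`. -/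
theorem step_r0b : Step [B, A, B, A] [B, B, B, B] :=
  ⟨[], [B, A, B, A], [B, B, B, B], [], by simp [Rule], rfl, rfl⟩

/-- (R1) THE GLIDER: `aaaab ~ baaaa` in four moves,
`aaaab → babab → bbbbb → bbaba → baaaa`. -/
theorem conn_glider : Conn [A, A, A, A, B] [B, A, A, A, A] := by
  unfold Conn
  refine Relation.ReflTransGen.head (b := [B, A, B, A, B])
    ⟨[], [A, A, A, A], [B, A, B, A], [B], by simp [Rule], rfl, rfl⟩ ?_
  refine Relation.ReflTransGen.head (b := [B, B, B, B, B])
    ⟨[], [B, A, B, A], [B, B, B, B], [B], by simp [Rule], rfl, rfl⟩ ?_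
  refine Relation.ReflTransGen.head (b := [B, B, A, B, A])
    ⟨[B], [B, B, B, B], [B, A, B, A], [], by simp [Rule], rfl, rfl⟩ ?_
  refine Relation.ReflTransGen.head (b := [B, A, A, A, A])
    ⟨[B], [B, A, B, A], [A, A, A, A], [], by simp [Rule], rfl, rfl⟩ ?_
  exact Relation.ReflTransGen.refl

/-- (R2) THE DOUBLET FLIP AT A GLIDER: `abaaaaa ~ bbbaaaa` in five moves,
`abaaaaa → abababa → aaaaaba → babaaba → bbbbaba → bbbaaaa`. -/
theorem conn_flip : Conn [A, B, A, A, A, A, A] [B, B, B, A, A, A, A] := by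
  unfold Conn
  refine Relation.ReflTransGen.head (b := [A, B, A, B, A, B, A])
    ⟨[A, B, A], [A, A, A, A], [B, A, B, A], [], by simp [Rule], rfl, rfl⟩ ?_
  refine Relation.ReflTransGen.head (b := [A, A, A, A, A, B, A])
    ⟨[A], [B, A, B, A], [A, A, A, A], [B, A], by simp [Rule], rfl, rfl⟩ ?_
  refine Relation.ReflTransGen.head (b := [B, A, B, A, A, B, A])
    ⟨[], [A, A, A, A], [B, A, B, A], [A, B, A], by simp [Rule], rfl, rfl⟩ ?_
  refine Relation.ReflTransGen.head (b := [B, B, B, B, A, B, A])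
    ⟨[], [B, A, B, A], [B, B, B, B], [A, B, A], by simp [Rule], rfl, rfl⟩ ?_
  refine Relation.ReflTransGen.head (b := [B, B, B, A, A, A, A])
    ⟨[B, B, B], [B, A, B, A], [A, A, A, A], [], by simp [Rule], rfl, rfl⟩ ?_
  exact Relation.ReflTransGen.refl

/-- (R2, trivial case) `aaaaaaa ~ babaaaa` in one move. -/
theorem conn_flip₀ : Conn [A, A, A, A, A, A, A] [B, A, B, A, A, A, A] := by
  unfold Conn
  exact Relation.ReflTransGen.single ⟨[], [A, A, A, A], [B, A, B, A], [A, A, A], by simp [Rule], rfl, rfl⟩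

/-- The glider passes one letter: `aaaa c ~ c aaaa`. -/
theorem conn_glider_letter (c : Bool) : Conn ([A, A, A, A] ++ [c]) ([c] ++ [A, A, A, A]) := by
  cases c
  · exact Relation.ReflTransGen.refl
  · exact conn_glider

/-- (G) GLIDER TRANSPORT: a block `aaaa` can be moved through any word, `p ++ aaaa ++ q ~ p ++ q ++ aaaa`
(so every non-frozen word is connected to a word ending in `aaaa`, Lemma 3 of the note, once an active
factor has been rewritten to `aaaa` by (R0)). -/
theorem conn_glider_transport (p q : Word) :
    Conn (p ++ [A, A, A, A] ++ q) (p ++ q ++ [A, A, A, A]) := by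
  induction q generalizing p with
  | nil => simpa using conn_refl (p ++ [A, A, A, A])
  | cons c q ih =>
    have h1 : Conn (p ++ [A, A, A, A] ++ c :: q) (p ++ [c] ++ [A, A, A, A] ++ q) := by
      have := conn_append (conn_glider_letter c) p q
      simpa [List.append_assoc] using this
    have h2 := ih (p ++ [c])
    have h2' : Conn (p ++ [c] ++ [A, A, A, A] ++ q) (p ++ c :: q ++ [A, A, A, A]) := by
      simpa [List.append_assoc] using h2
    exact conn_trans h1 h2'

/-- Sanity values: the charges of the endpoints of (R2) agree (as `charges_conn conn_flip` also proves),
`D1 (abaaaaa) = D1 (bbbaaaa) = 0`, `D2 = 1`; and `a⁸`, `b⁸` both have charges `(0, 0)`. -/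
example : D1 [A, B, A, A, A, A, A] = 0 ∧ D1 [B, B, B, A, A, A, A] = 0 ∧
    D2 [A, B, A, A, A, A, A] = 1 ∧ D2 [B, B, B, A, A, A, A] = 1 ∧
    D1 [B, B, B, B, B, B, B, B] = 0 ∧ D2 [B, B, B, B, B, B, B, B] = 0 := by decide

end Summit.QuantumAdvantage.Dequantization.EquationalRewriting
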